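import Literature.NumberTheory.LFunctions.Zhang2022.DetectorEntangledCone

/-!
# Zhang (2022), programme F-S3 (cell landau-siegel, family B-det / §E E-102): the THREE-MOMENT COLLAPSE of
# formula I for shift recipes — `π·M_b(g,h) = m₀(b)·Q_b(g,h) − iπ·m_s(b)·(⟨g′,h⟩ + ⟨g,h′⟩) − π²·m_n(b)·g(0)·conj ∫h`

Y. Zhang, *Discrete mean estimates and the Landau–Siegel zero*, arXiv:2211.02515v1 [Zhang2022LandauSiegel] —
an unrefereed manuscript under adjudication. **WHAT THIS IS NOT: not a claim about Theorems 1–2 of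
arXiv:2211.02515, about Landau–Siegel zeros, or about Parity; nothing here asserts any claim of the manuscript.**
«The programme SEARCHES and TYPES; no claim about Landau–Siegel zeros, Theorems 1–2 of arXiv:2211.02515 or a
repaired Margin232 until a kernel theorem says so.»

A KERNEL IDENTITY serving the cell's E-102 discharge packet (`B-det/plan/E102-DISCHARGE.md` v1.1: LINE A model
transfer, LINE B Gram kernel, H2-struct) and the §E slot E-010 (ii): formula I of a shift triple (printed for
`b = (1,2,3)` in Prop 7.1, (8.11)–(8.23); for an arbitrary real triple, repeats included, it is `Det.MformDD b` of
`DetectorShiftMomentsDD`, with the six channel moments `m₀, m_s, m_n, m_b, m_bs, m_bn` = confluent divided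
differences of `t ↦ t^k e^{iπ(B−t)}` at the nodes, `B = Σb/2`) COLLAPSES to THREE moment kernels.

* **The shift relations (Part 1, PROVED for every real triple):** `m_b = e₁·m₀ − m_s`, `m_bn = e₃·m₀`
  (definitional in `DetectorShiftMomentsDD`: `m_s := 2B·m₀ − m_b`, `m_bn := N·m₀`) and the new one
  **`m_n + m_bs = e₂·m₀`** (`ddMn_add_ddMbs`), `e₁ = Σ b_j = 2B`, `e₂ = Σ_{i<j} b_ib_j`, `e₃ = Πb_j = N`: the
  combination `h₃ − e₁h₂ + e₂h₁ − e₃h₀` of the node functions is `ω·g_B` with `ω(t) = Π_j(t − b_j)` the NODE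
  POLYNOMIAL, whose confluent second divided difference at its own nodes vanishes (`ω` vanishes at the nodes, `ω′` at
  a double node, `ω″` at a triple node). For distinct nodes these are the per-channel identities `s_j + b_j = e₁`,
  `n_j + b_js_j = e₂`, `b_jn_j = e₃` of `Det.shiftS`/`shiftN`.
* **The collapse (Part 2, PROVED, no hypothesis on the profiles):** substituting the relations into `Det.MformOf`,
  `π·MformDD b g h = m₀(b)·Q_b(g,h) − iπ·m_s(b)·(⟨g′,h⟩ + ⟨g,h′⟩) − π²·m_n(b)·g(0)·conj(∫₀¹h)` (`mformDD_eq_collapse`),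
  where **`Q_b(g,h) = shiftCore e₁ e₂ e₃ g h := ⟨g′,h′⟩ + iπe₁⟨g,h′⟩ + π²e₂⟨g,h⟩ + iπ³e₃·(∫g·conj∫h − ⟨g,S_h⟩)`**
  (`⟨u,v⟩ = ∫₀¹u·conj v`, `S_h(x) = ∫₀ˣh`) depends on the triple ONLY through its elementary symmetric functions.
  OPERATOR READING (docstring only): with `P_h(t) = ∫_t^1 h` and `D_c = d/dt + iπc`, the channel integrands of Prop 7.1
  are `(D_{b_j}g)·conj(−D_{b_k}D_{b_l}P_h)`, and `D_{b_j}D_{b_k}D_{b_l} = D_{b₀}D_{b₁}D_{b₂}` is the same operator in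
  every channel — `Q_b` is the form `⟨g, D_{b₀}D_{b₁}D_{b₂}P_h⟩` after one integration by parts.
* **One-sided profiles (Part 3, PROVED):** for kinked `g, h` (`Repair.KinkedProfile`),
  `⟨g′,h⟩ + ⟨g,h′⟩ = g(1)·conj h(1) − g(0)·conj h(0)` (`integral_deriv_mul_conj_add`); hence on the one-sided class
  (`g(1) = 0`) `π·MformDD b g h = m₀·Q_b(g,h) + iπ·m_s·g(0)·conj h(0) − π²·m_n·g(0)·conj ∫h`
  (`mformDD_eq_collapse_oneSided`) and the diagonal recipe form is
  **`FormDetDD b g = (2/π)·Re(m₀(b)·Q_b(g,g)) − 2·Im(m_s(b))·|g(0)|² − 2π·Re(m_n(b)·g(0)·conj ∫g)`**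
  (`formDetDD_eq_collapse`; `formDet_shiftRecipe_eq_collapse` for `Det.FormDet (Det.shiftRecipe b)`, distinct `b`).
* **Check at the printed triple (Part 4):** `(m₀, m_s, m_n) = (4, 15, 12)`, `(e₁,e₂,e₃) = (6, 11, 6)` reproduce the
  manuscript's `𝔅 = (8/π)‖g′‖² + 48Im⟨g′,g⟩ + 88π‖g‖² − 24πRe(g(0)Ī) − 48π²Im(|I|² − ⟨g,S_g⟩)` (`collapse_std`, via
  `Det.formDet_eq_moments` / `moments_zhang`).

Why it matters for E-102 (both heads, `Det.EdetPremise`): the block kernel `(x,y) ↦ FormDetPolarDD (a,x,y)` and the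
monomial forms `𝔅_{R(b)}` are governed by three divided-difference kernels `m₀, m_s, m_n` and ONE constant-coefficient
form per triple; this is the demodulation-ready shape of the cell's O15 route (`MainTermFormPSD`: at `b = (1,2,3)` the
bulk `(8/π)Re Q_{(1,2,3)}` diagonalises on quarter-wave modes with eigenvalues `π⁴(k−1)k(k+1)(k+2)`). ORIENTATION ONLY
(not used, not asserted as a theorem): the frequency symbol of `Q_b` at a profile frequency `ν` is `∝ ν·Π_j(b_j − ν)`, whose
sign on the integers `ν ≥ 1` is the lattice-symbol condition of `Det.signAdmissible_iff_latticeSymbolNonpos`; an O15-style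
demodulation needs that zero set `{0, b₀, b₁, b₂}` to be symmetric, i.e. (up to order) `b₂ = b₀ + b₁` — the surface
containing `(1,2,3)`, `(1;k,k+1)` and the cell's E-010 members `(1/2;2,5/2)`, `(1/2;5/2,3)`, `(1/2;3/2,2)`, `(1/2;1,3/2)`.
Nothing here is asserted about positivity off the printed triple. Elementary calculus and algebra; 0 named facts,
0 sorries.

## References

* Y. Zhang, arXiv:2211.02515v1 (2022), Prop 7.1 p.44 with (7.19)–(7.21), §8 (8.11)–(8.23), Lemmas 8.2/8.4.
  [cite: Zhang2022LandauSiegel, Prop 7.1 p.44]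
* Cell documents (not literature): `B-det/plan/E102-DISCHARGE.md` v1.1 (7479f71c5e829043) §§2–3; the desk note of
  ls-Bdet-typer-2 g2, 2026-08-27T00:35Z.
-/

noncomputable section

open Complex Real ComplexConjugate Set MeasureTheory intervalIntegral

namespace Literature.NumberTheory.LFunctions.Zhang2022

namespace Det

open Repair

variable {b : Fin 3 → ℝ} {g g' h h' : ℝ → ℂ}

/-! ### Part 1 — the shift relations among the six dd-moments (every real triple) -/

/-- `e₁(b) = b₀ + b₁ + b₂`. [cite: Zhang2022LandauSiegel, §8 (8.13)–(8.18)] -/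
def symE1 (b : Fin 3 → ℝ) : ℝ := b 0 + b 1 + b 2

/-- `e₂(b) = b₀b₁ + b₀b₂ + b₁b₂`. [cite: Zhang2022LandauSiegel, §8 (8.13)–(8.18)] -/
def symE2 (b : Fin 3 → ℝ) : ℝ := b 0 * b 1 + b 0 * b 2 + b 1 * b 2

/-- `e₃(b) = b₀b₁b₂`. [cite: Zhang2022LandauSiegel, §8 (8.13)–(8.18)] -/
def symE3 (b : Fin 3 → ℝ) : ℝ := b 0 * b 1 * b 2

/-- `2B = e₁`. [cite: Zhang2022LandauSiegel, Lemma 5.2 p.10] -/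
theorem two_mul_shiftB (b : Fin 3 → ℝ) : 2 * shiftB b = symE1 b := by
  rw [shiftB, symE1]; ring

/-- **`m_b = e₁·m₀ − m_s`** (definitional: `m_s := 2B·m₀ − m_b`). [cite: Zhang2022LandauSiegel, §8 (8.13)–(8.18)] -/
theorem ddMb_eq (b : Fin 3 → ℝ) : ddMb b = (symE1 b : ℂ) * ddM0 b - ddMs b := by
  rw [ddMs, ← two_mul_shiftB]; push_cast; ring

/-- **`m_bn = e₃·m₀`** (definitional). [cite: Zhang2022LandauSiegel, §8 (8.13)–(8.18)] -/
theorem ddMbn_eq (b : Fin 3 → ℝ) : ddMbn b = (symE3 b : ℂ) * ddM0 b := by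
  rw [ddMbn, symE3]

/-- `h[p,p,p] = h″(p)/2`. [folklore] -/
private theorem dd2_self (h h' h'' : ℝ → ℂ) (x : ℝ) : dd2 h h' h'' x x x = h'' x / 2 := by
  rw [dd2, if_neg (fun hh => hh.1 rfl), if_pos ⟨rfl, rfl⟩]

/-- `h[p,p,q]`, `p ≠ q`. [folklore] -/
private theorem dd2_left (h h' h'' : ℝ → ℂ) {x z : ℝ} (hxz : x ≠ z) :
    dd2 h h' h'' x x z = ((h z - h x) / ((z - x : ℝ) : ℂ) - h' x) / ((z - x : ℝ) : ℂ) := by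
  rw [dd2, if_neg (fun hh => hh.1 rfl), if_neg (fun hh => hxz hh.2), if_pos rfl]

/-- `h[p,q,q]`, `p ≠ q`. [folklore] -/
private theorem dd2_right (h h' h'' : ℝ → ℂ) {x y : ℝ} (hxy : x ≠ y) :
    dd2 h h' h'' x y y = ((h x - h y) / ((x - y : ℝ) : ℂ) - h' y) / ((x - y : ℝ) : ℂ) := by
  rw [dd2, if_neg (fun hh => hh.2.1 rfl), if_neg (fun hh => hxy hh.1), if_neg hxy, if_pos rfl]

/-- `h[p,q,p]`, `p ≠ q`. [folklore] -/
private theorem dd2_outer (h h' h'' : ℝ → ℂ) {x y : ℝ} (hxy : x ≠ y) :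
    dd2 h h' h'' x y x = ((h y - h x) / ((y - x : ℝ) : ℂ) - h' x) / ((y - x : ℝ) : ℂ) := by
  rw [dd2, if_neg (fun hh => hh.2.2 rfl), if_neg (fun hh => hxy hh.1), if_neg hxy, if_neg (fun e => hxy e.symm)]

/-- **The node-polynomial identity:** for ANY phase `B` and ANY real nodes `x, y, z` (coincidences allowed),
`h₃[x,y,z] − e₁·h₂[x,y,z] + e₂·h₁[x,y,z] − e₃·h₀[x,y,z] = 0` for the confluent divided differences of
`h_k(t) = t^k e^{iπ(B−t)}` (`e₁ = x+y+z`, `e₂ = xy+xz+yz`, `e₃ = xyz`): the combination is `ω·g_B`,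
`ω(t) = (t−x)(t−y)(t−z)`, which vanishes to the right order at every node. [cite: Zhang2022LandauSiegel, proof of Prop 7.1, (7.19)–(7.21)] -/
theorem dd2_nodePoly (B x y z : ℝ) :
    dd2 (ddBase B 3) (ddBase' B 3) (ddBase'' B 3) x y z
      - ((x + y + z : ℝ) : ℂ) * dd2 (ddBase B 2) (ddBase' B 2) (ddBase'' B 2) x y z
      + ((x * y + x * z + y * z : ℝ) : ℂ) * dd2 (ddBase B 1) (ddBase' B 1) (ddBase'' B 1) x y z
      - ((x * y * z : ℝ) : ℂ) * dd2 (ddBase B 0) (ddBase' B 0) (ddBase'' B 0) x y z = 0 := by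
  by_cases hxy : x = y
  · subst hxy
    by_cases hxz : x = z
    · subst hxz
      simp only [dd2_self, ddBase'']
      push_cast
      ring
    · simp only [dd2_left _ _ _ hxz, ddBase, ddBase']
      push_cast
      ring
  · by_cases hyz : y = z
    · subst hyz
      simp only [dd2_right _ _ _ hxy, ddBase, ddBase']
      push_cast
      ring
    · by_cases hxz : x = z
      · subst hxz
        simp only [dd2_outer _ _ _ hxy, ddBase, ddBase']
        push_cast
        ring
      · simp only [dd2_of_ne _ _ _ hxy hyz hxz, ddBase]
        push_cast
        ring

/-- The node-polynomial identity for the dd-values of a triple `b`: `ddOf b 3 − e₁·ddOf b 2 + e₂·ddOf b 1 − e₃·ddOf b 0 = 0`.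
[cite: Zhang2022LandauSiegel, proof of Prop 7.1, (7.19)–(7.21)] -/
theorem ddOf_nodePoly (b : Fin 3 → ℝ) :
    ddOf b 3 - (symE1 b : ℂ) * ddOf b 2 + (symE2 b : ℂ) * ddOf b 1 - (symE3 b : ℂ) * ddOf b 0 = 0 :=
  dd2_nodePoly (shiftB b) (b 0) (b 1) (b 2)

/-- **`m_n + m_bs = e₂·m₀`** for every real triple (per channel `n_j + b_js_j = e₂`; at coincidences by the node-polynomial
identity). [cite: Zhang2022LandauSiegel, §8 (8.13)–(8.18)] -/
theorem ddMn_add_ddMbs (b : Fin 3 → ℝ) : ddMn b + ddMbs b = (symE2 b : ℂ) * ddM0 b := by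
  have h := ddOf_nodePoly b
  simp only [ddMn, ddMbs, ddMb, ddM0, symE1, symE3, shiftB] at h ⊢
  push_cast at h ⊢
  linear_combination (-1 : ℂ) * h

/-- `m_bs = e₂·m₀ − m_n`. [cite: Zhang2022LandauSiegel, §8 (8.13)–(8.18)] -/
theorem ddMbs_eq (b : Fin 3 → ℝ) : ddMbs b = (symE2 b : ℂ) * ddM0 b - ddMn b := by
  have h := ddMn_add_ddMbs b
  linear_combination h

/-! ### Part 2 — the collapsed formula I -/

/-- **The core form `Q_{e}(g,h) = ⟨g′,h′⟩ + iπe₁⟨g,h′⟩ + π²e₂⟨g,h⟩ + iπ³e₃(∫g·conj∫h − ⟨g,S_h⟩)`** — formula I's bulk with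
the triple entering only through `(e₁,e₂,e₃)` (the constant-coefficient operator `D_{b₀}D_{b₁}D_{b₂}` paired against `g`).
[cite: Zhang2022LandauSiegel, Prop 7.1 p.44, (8.11)–(8.12)] -/
def shiftCore (e1 e2 e3 : ℝ) (g g' h h' : ℝ → ℂ) : ℂ :=
  (∫ x in (0:ℝ)..1, g' x * conj (h' x))
    + I * π * (e1 : ℂ) * (∫ x in (0:ℝ)..1, g x * conj (h' x))
    + (π : ℂ) ^ 2 * (e2 : ℂ) * (∫ x in (0:ℝ)..1, g x * conj (h x))
    + I * (π : ℂ) ^ 3 * (e3 : ℂ) * ((∫ x in (0:ℝ)..1, g x) * conj (∫ x in (0:ℝ)..1, h x)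
        - ∫ x in (0:ℝ)..1, g x * conj (∫ t in (0:ℝ)..x, h t))

/-- **Collapse of the parametric formula I under the shift relations** (pure algebra, any profiles): with
`m_b = e₁m₀ − m_s`, `m_bs = e₂m₀ − m_n`, `m_bn = e₃m₀`,
`MformOf = (1/π)·(m₀·Q_e(g,h) − iπ·m_s·(⟨g′,h⟩ + ⟨g,h′⟩) − π²·m_n·g(0)·conj ∫h)`.
[cite: Zhang2022LandauSiegel, Prop 7.1 p.44, (8.11)–(8.12)] -/
theorem mformOf_of_shiftRelations (m0 ms mn : ℂ) (e1 e2 e3 : ℝ) (g g' h h' : ℝ → ℂ) :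
    MformOf m0 ms mn ((e1 : ℂ) * m0 - ms) ((e2 : ℂ) * m0 - mn) ((e3 : ℂ) * m0) g g' h h'
      = (((1 / π : ℝ)) : ℂ) *
        (m0 * shiftCore e1 e2 e3 g g' h h'
          - I * π * (ms * ((∫ x in (0:ℝ)..1, g' x * conj (h x)) + ∫ x in (0:ℝ)..1, g x * conj (h' x)))
          - (π : ℂ) ^ 2 * (mn * (g 0 * conj (∫ x in (0:ℝ)..1, h x)))) := by
  unfold MformOf shiftCore
  ring

/-- **THE COLLAPSE — formula I of an arbitrary real shift triple has three moment kernels:**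
`MformDD b g h = (1/π)·(m₀(b)·Q_b(g,h) − iπ·m_s(b)·(⟨g′,h⟩ + ⟨g,h′⟩) − π²·m_n(b)·g(0)·conj ∫h)`, NO hypothesis on the
profiles, repeats allowed. [cite: Zhang2022LandauSiegel, Prop 7.1 p.44, (7.19)–(7.21), (8.11)–(8.12)] -/
theorem mformDD_eq_collapse (b : Fin 3 → ℝ) (g g' h h' : ℝ → ℂ) :
    MformDD b g g' h h'
      = (((1 / π : ℝ)) : ℂ) *
        (ddM0 b * shiftCore (symE1 b) (symE2 b) (symE3 b) g g' h h'
          - I * π * (ddMs b * ((∫ x in (0:ℝ)..1, g' x * conj (h x)) + ∫ x in (0:ℝ)..1, g x * conj (h' x)))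
          - (π : ℂ) ^ 2 * (ddMn b * (g 0 * conj (∫ x in (0:ℝ)..1, h x)))) := by
  rw [MformDD, ddMb_eq, ddMbs_eq, ddMbn_eq, mformOf_of_shiftRelations]

/-! ### Part 3 — one-sided profiles: the boundary identity and the collapsed diagonal form -/

/-- **Integration by parts for kinked profiles:** `∫₀¹ g′·conj h + ∫₀¹ g·conj h′ = g(1)·conj h(1) − g(0)·conj h(0)`.
[cite: Zhang2022LandauSiegel, Prop 7.1 with (8.11)–(8.23), pp.44–50] -/
theorem integral_deriv_mul_conj_add (hg : KinkedProfile g g') (hh : KinkedProfile h h') :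
    (∫ x in (0:ℝ)..1, g' x * conj (h x)) + (∫ x in (0:ℝ)..1, g x * conj (h' x))
      = g 1 * conj (h 1) - g 0 * conj (h 0) := by
  have hΦc : ContinuousOn (fun x => g x * conj (h x)) (Icc 0 1) := hg.cont.mul (continuousOn_conj_comp hh.cont)
  have hΦd : ∀ x ∈ Ioo (0:ℝ) 1, HasDerivWithinAt (fun x => g x * conj (h x))
      (g' x * conj (h x) + g x * conj (h' x)) (Ioi x) x := by
    intro x hx
    have h1 := hg.hasDeriv x hx
    have h2 : HasDerivWithinAt (fun y => conj (h y)) (conj (h' x)) (Ioi x) x := by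
      have := (hh.hasDeriv x hx).star
      simpa only [starRingEnd_apply] using this
    exact h1.mul h2
  have hi1 : IntervalIntegrable (fun x => g' x * conj (h x)) volume 0 1 :=
    hg.isH1.intervalIntegrable_deriv_mul_conj hh.isH1
  have hi2 : IntervalIntegrable (fun x => g x * conj (h' x)) volume 0 1 := by
    have hc : IntervalIntegrable (fun x => conj (h' x)) volume 0 1 := by
      rw [intervalIntegrable_iff, uIoc_of_le zero_le_one]
      exact hh.isH1.memLp_conj.integrable one_le_two
    exact hc.continuousOn_mul (by rw [uIcc_of_le zero_le_one]; exact hg.cont)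
  have key := intervalIntegral.integral_eq_sub_of_hasDeriv_right_of_le zero_le_one hΦc hΦd (hi1.add hi2)
  rw [intervalIntegral.integral_add hi1 hi2] at key
  exact key

/-- On the one-sided class (`g(1) = 0`): `⟨g′,h⟩ + ⟨g,h′⟩ = −g(0)·conj h(0)`. [cite: Zhang2022LandauSiegel, Prop 7.1 p.44, (7.2)] -/
theorem integral_deriv_mul_conj_add_oneSided (hg : KinkedProfile g g') (hh : KinkedProfile h h') (hg1 : g 1 = 0) :
    (∫ x in (0:ℝ)..1, g' x * conj (h x)) + (∫ x in (0:ℝ)..1, g x * conj (h' x)) = -(g 0 * conj (h 0)) := by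
  rw [integral_deriv_mul_conj_add hg hh, hg1, zero_mul, zero_sub]

/-- **Collapsed formula I on the one-sided class:**
`π·MformDD b g h = m₀·Q_b(g,h) + iπ·m_s·g(0)·conj h(0) − π²·m_n·g(0)·conj ∫h` — bulk + two APEX-AT-ZERO terms.
[cite: Zhang2022LandauSiegel, Prop 7.1 p.44, (7.2), (8.11)–(8.12)] -/
theorem mformDD_eq_collapse_oneSided (b : Fin 3 → ℝ) (hg : KinkedProfile g g') (hh : KinkedProfile h h')
    (hg1 : g 1 = 0) :
    MformDD b g g' h h'
      = (((1 / π : ℝ)) : ℂ) *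
        (ddM0 b * shiftCore (symE1 b) (symE2 b) (symE3 b) g g' h h'
          + I * π * (ddMs b * (g 0 * conj (h 0)))
          - (π : ℂ) ^ 2 * (ddMn b * (g 0 * conj (∫ x in (0:ℝ)..1, h x)))) := by
  rw [mformDD_eq_collapse, integral_deriv_mul_conj_add_oneSided hg hh hg1]
  ring

/-- **The diagonal recipe form of ANY real triple on the one-sided class — three moments:**
`FormDetDD b g = (2/π)·Re(m₀(b)·Q_b(g,g)) − 2·Im(m_s(b))·|g(0)|² − 2π·Re(m_n(b)·g(0)·conj ∫₀¹g)`.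
[cite: Zhang2022LandauSiegel, Prop 7.1 p.44 with (8.11)–(8.23)] -/
theorem formDetDD_eq_collapse (b : Fin 3 → ℝ) (hg : KinkedProfile g g') (hg1 : g 1 = 0) :
    FormDetDD b g g'
      = 2 / π * (ddM0 b * shiftCore (symE1 b) (symE2 b) (symE3 b) g g' g g').re
        - 2 * (ddMs b).im * ‖g 0‖ ^ 2
        - 2 * π * (ddMn b * (g 0 * conj (∫ x in (0:ℝ)..1, g x))).re := by
  rw [← formDetPolarDD_self_re, FormDetPolarDD, mformDD_eq_collapse_oneSided b hg hg hg1]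
  have hsq : (g 0 * conj (g 0)) = ((‖g 0‖ ^ 2 : ℝ) : ℂ) := by
    rw [Complex.mul_conj', Complex.ofReal_pow]
  rw [hsq]
  set Q : ℂ := ddM0 b * shiftCore (symE1 b) (symE2 b) (symE3 b) g g' g g'
  set T : ℂ := ddMn b * (g 0 * conj (∫ x in (0:ℝ)..1, g x))
  set M : ℂ := ddMs b
  have hπ : (π : ℝ) ≠ 0 := Real.pi_ne_zero
  simp only [Complex.mul_re, Complex.mul_im, Complex.add_re, Complex.add_im, Complex.sub_re, Complex.sub_im,
    Complex.ofReal_re, Complex.ofReal_im, Complex.I_re, Complex.I_im, Complex.conj_re]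
  simp only [← Complex.ofReal_pow, Complex.ofReal_re, Complex.ofReal_im]
  field_simp
  ring

/-- … and for a DISTINCT triple the recipe form `𝔅_{R(b)} = Det.FormDet (Det.shiftRecipe b)` itself.
[cite: Zhang2022LandauSiegel, Prop 7.1 p.44 with (8.11)–(8.23)] -/
theorem formDet_shiftRecipe_eq_collapse (hb : Function.Injective b) (hg : KinkedProfile g g') (hg1 : g 1 = 0) :
    FormDet (shiftRecipe b) g g'
      = 2 / π * (ddM0 b * shiftCore (symE1 b) (symE2 b) (symE3 b) g g' g g').re
        - 2 * (ddMs b).im * ‖g 0‖ ^ 2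
        - 2 * π * (ddMn b * (g 0 * conj (∫ x in (0:ℝ)..1, g x))).re := by
  rw [← formDetDD_eq_formDet hb hg hg1, formDetDD_eq_collapse b hg hg1]

/-- The polar block of an arbitrary triple on the one-sided class, collapsed (both profiles one-sided kinked).
[cite: Zhang2022LandauSiegel, Prop 7.1 p.44, (8.11)–(8.12)] -/
theorem formDetPolarDD_eq_collapse (b : Fin 3 → ℝ) (hg : KinkedProfile g g') (hh : KinkedProfile h h')
    (hg1 : g 1 = 0) (hh1 : h 1 = 0) :
    FormDetPolarDD b g g' h h'
      = (((1 / π : ℝ)) : ℂ) *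
          (ddM0 b * shiftCore (symE1 b) (symE2 b) (symE3 b) g g' h h'
            + I * π * (ddMs b * (g 0 * conj (h 0)))
            - (π : ℂ) ^ 2 * (ddMn b * (g 0 * conj (∫ x in (0:ℝ)..1, h x))))
        + conj ((((1 / π : ℝ)) : ℂ) *
          (ddM0 b * shiftCore (symE1 b) (symE2 b) (symE3 b) h h' g g'
            + I * π * (ddMs b * (h 0 * conj (g 0)))
            - (π : ℂ) ^ 2 * (ddMn b * (h 0 * conj (∫ x in (0:ℝ)..1, g x))))) := by
  rw [FormDetPolarDD, mformDD_eq_collapse_oneSided b hg hh hg1, mformDD_eq_collapse_oneSided b hh hg hh1]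

/-! ### Part 4 — the printed triple: `(m₀, m_s, m_n) = (4, 15, 12)`, `(e₁, e₂, e₃) = (6, 11, 6)` -/

/-- `e₁(1,2,3) = 6`, `e₂ = 11`, `e₃ = 6`. [cite: Zhang2022LandauSiegel, §8 (8.13)–(8.18)] -/
theorem symE_std : symE1 ![1, 2, 3] = 6 ∧ symE2 ![1, 2, 3] = 11 ∧ symE3 ![1, 2, 3] = 6 := by
  refine ⟨?_, ?_, ?_⟩ <;>
    simp [symE1, symE2, symE3, Matrix.cons_val_zero, Matrix.cons_val_one, Matrix.cons_val_two, Matrix.head_cons,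
      Matrix.tail_cons] <;> norm_num

/-- The three collapse moments at the printed triple: `m₀ = 4`, `m_s = 15`, `m_n = 12` (the printed six are
`(4,15,12,9,32,24)`, `Det.moments_zhang`; the other three follow from the shift relations: `9 = 6·4 − 15`,
`32 = 11·4 − 12`, `24 = 6·4`). [cite: Zhang2022LandauSiegel, Prop 7.1 with (8.11)–(8.23), pp.44–50] -/
theorem collapseMoments_std : ddM0 ![1, 2, 3] = 4 ∧ ddMs ![1, 2, 3] = 15 ∧ ddMn ![1, 2, 3] = 12 := by
  have hinj : Function.Injective (![1, 2, 3] : Fin 3 → ℝ) := signAdmissible_std.injective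
  obtain ⟨h0, hs, hn, -, -, -⟩ := moments_zhang
  refine ⟨?_, ?_, ?_⟩
  · rw [← sum_shiftW_eq_ddM0 hinj, shiftRecipe_std]; exact h0
  · rw [← sum_shiftW_s_eq_ddMs hinj, shiftRecipe_std]; exact hs
  · rw [← sum_shiftW_n_eq_ddMn hinj, shiftRecipe_std]; exact hn

/-- **Check at the printed triple:** the collapsed form IS the manuscript's one-sided `𝔅`:
`𝔅(g) = (8/π)·Re Q_{(6,11,6)}(g,g) − 24π·Re(g(0)·conj ∫g)` on one-sided kinked profiles (`m_s = 15` is real, so the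
`|g(0)|²` term is absent). [cite: Zhang2022LandauSiegel, Prop 7.1 with (8.11)–(8.23), pp.44–50; §4 (4.1)] -/
theorem collapse_std (hg : KinkedProfile g g') (hg1 : g 1 = 0) :
    mainTermForm g g'
      = 8 / π * (shiftCore 6 11 6 g g' g g').re - 24 * π * (g 0 * conj (∫ x in (0:ℝ)..1, g x)).re := by
  have h := formDet_shiftRecipe_eq_collapse (g := g) (g' := g') signAdmissible_std.injective hg hg1
  rw [shiftRecipe_std, FormDet_zhang hg hg1] at h
  obtain ⟨h0, hs, hn⟩ := collapseMoments_std
  obtain ⟨e1, e2, e3⟩ := symE_std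
  rw [h0, hs, hn, e1, e2, e3] at h
  rw [h]
  simp only [Complex.mul_re, Complex.re_ofNat, Complex.im_ofNat, zero_mul, sub_zero, mul_zero]
  ring

end Det

end Literature.NumberTheory.LFunctions.Zhang2022
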